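import Summits.ValiantsHypothesis.ValiantsHypothesis.Theorems.SymPencilSdcPerThreeThirteen
import Summits.ValiantsHypothesis.ValiantsHypothesis.Theorems.SymPencilSdcPerFourTwentyFive

/-!
# Route `SymPencil` — `sdc(per₄) ≤ 29`: an explicit symmetric affine determinantal representation
# of `per₄` of size `29` (`--supports` stmt-ValiantsHypothesis-5674 `SdcSuperquadratic`; calibration)

CALIBRATION (decides nothing about the crux `SdcSuperquadratic`; nothing here bears on `VP ≠ VNP`).
The tree's window for the symmetric determinantal complexity of the `4 × 4` permanent was
`25 ≤ sdc(per₄) ≤ 306` (`SymPencilSdcPerFourTwentyFive.sdc_perPoly_four_window_twentyFive`: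
the cell's kernel-package ladder `17 → 19 → 21 → 23 → 25` from below, Quarez's universal bound from
above).  This file narrows it to **`25 ≤ sdc(per₄) ≤ 29`** over every field of characteristic `0`,
by an explicit `29 × 29` symmetric pencil — the bordered Schur design of
`SymPencilSdcPerThreeThirteen` run one level deeper on the Laplace expansion of `per₄` along the
row pairs `{0,1} | {2,3}`:

  `per₄ = Σ_{ {c,d} } h_{cd} · g_{cd}`,  `g_{cd} = x_{2c} x_{3d} + x_{2d} x_{3c}`,
  `h_{cd} = x_{0j} x_{1k} + x_{0k} x_{1j}` (`{j,k}` the complementary column pair; six terms).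

The pencil, on the index set `(Unit ⊕ (β ⊕ β)) ⊕ (Fin 6 ⊕ Fin 6)` (`β = Fin 2 × Fin 4` = the eight
variables of rows `1` and `3`), is

  `A = [[A₁₁, A₁₂], [A₁₂ᵀ, T]]`,  `A₁₁ = [[0, (r,0)ᵀ], [(r,0), [[0, 1₈], [1₈, 0]]]]`,  `T = [[0, 1₆], [1₆, 0]]`,

where `r = (x_{1·}, x_{3·}) ∈ K⁸` is the border and `A₁₂` is supported on the `B'`-rows, where it is
`Y = [Y₁(v) | Y₂(r₂)]` with `Y₁ᵀ r = (−⅟2 · h_{cd})_{cd}` (entries `−⅟2 · x_{0j}` on the row-`1`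
slots) and `Y₂ᵀ r = (g_{cd})_{cd}` (entries `x_{2c}` on the row-`3` slots).  Eliminating the
invertible constant block `T` (`T⁻¹ = T`, `det T = 1`) replaces the zero pairing block of `A₁₁` by
the Schur complement `S' = −(Y₁ Y₂ᵀ + Y₂ Y₁ᵀ)`, and the bordered-Schur determinant formula
(`SymPencilSdcPerThreeThirteen.det_bordered_fromBlocks`) gives
`det A = rᵀ S' r = −2 Σ_{cd} (Y₁ᵀr)_{cd} (Y₂ᵀr)_{cd} = Σ_{cd} h_{cd} g_{cd} = per₄`.
All entries are `0`, `1`, `±x`, or `−⅟2·x`: affine.  Size `1 + 8 + 8 + 12 = 29`.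

POSITION IN THE KERNEL PACKAGE.  `rank b = 8`, `V = ker b` = rows `{0, 2}` (two full rows, as the
BoxFour equality case demands), `B = im b` isotropic of dimension `8` in `K²⁸`, defect
`d = m − 1 − 2r = 12`: the cell `(8, 8, 12)` at `m = 29`.  So the first open sizes are now exactly
`m ∈ {25, 26, 27, 28}`; at `m = 25` the live cells are `(8,8,8)`, `(10,6,4)` and the one-row
Lagrangian `(12,4,0)` (crux notes `Cruxes/SdcPerBeyondN/NEXT-RUNG.md` (G),
`Cruxes/SdcSuperquadratic/NEXT-RUNG-25.md`).

Main declarations: `sum_sum_fromBlocks_swap` (the bilinear form of `[[0,1],[1,0]]`),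
`laplace_perPoly_four_rows` (the six-term Laplace expansion), `hasSymmDetRepr_perPoly_four_twentyNine`
(any commutative ring with `⅟2`), `sdc_perPoly_four_le_twentyNine`,
`sdc_perPoly_four_window_twentyNine` (`25 ≤ sdc(per₄) ≤ 29`, characteristic `0`) and its complex
instance.
-/

noncomputable section

-- single-conjunct layout: Sub = Summit, duplicated namespace component intended
set_option linter.dupNamespace false

namespace Summit.ValiantsHypothesis.ValiantsHypothesis.Theorems.SymPencilSdcPerFourTwentyNine

open Matrix MvPolynomial
open Literature.Computability.AlgebraicComplexity
open Summit.ValiantsHypothesis.ValiantsHypothesis.Theorems.SymPencilSdcPerThreeThirteen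
open Summit.ValiantsHypothesis.ValiantsHypothesis.Theorems.SymPencilSdcPerFourTwentyFive

/-! ### The bilinear form of the swap block -/

/-- `aᵀ [[0, 1], [1, 0]] b = Σ_i (a_{inl i} b_{inr i} + a_{inr i} b_{inl i})`. [folklore] -/
theorem sum_sum_fromBlocks_swap {κ P : Type*} [Fintype κ] [DecidableEq κ] [CommRing P]
    (a b : κ ⊕ κ → P) :
    ∑ k, ∑ l, a k * (Matrix.fromBlocks (0 : Matrix κ κ P) 1 1 0) k l * b l =
      ∑ i, (a (Sum.inl i) * b (Sum.inr i) + a (Sum.inr i) * b (Sum.inl i)) := by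
  simp only [Fintype.sum_sum_type, Matrix.fromBlocks_apply₁₁, Matrix.fromBlocks_apply₁₂,
    Matrix.fromBlocks_apply₂₁, Matrix.fromBlocks_apply₂₂, Matrix.zero_apply, Matrix.one_apply,
    mul_ite, mul_one, mul_zero, ite_mul, zero_mul, Finset.sum_ite_eq, Finset.mem_univ, if_true,
    Finset.sum_const_zero, zero_add, add_zero]
  rw [Finset.sum_add_distrib, add_comm]

/-! ### The six-term Laplace expansion of `per₄` along the row pairs `{0,1} | {2,3}` -/

/-- `per₄ = Σ_{ {c,d} } (x_{0j} x_{1k} + x_{0k} x_{1j}) (x_{2c} x_{3d} + x_{2d} x_{3c})`, the six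
column pairs `{c,d}` listed as `01, 02, 03, 12, 13, 23` with complements `23, 13, 12, 03, 02, 01`.
[folklore] -/
theorem laplace_perPoly_four_rows (R : Type*) [CommRing R] :
    ∑ i : Fin 6,
      ((X (0, (![2, 1, 1, 0, 0, 0] : Fin 6 → Fin 4) i) * X (1, (![3, 3, 2, 3, 2, 1] : Fin 6 → Fin 4) i) +
          X (0, (![3, 3, 2, 3, 2, 1] : Fin 6 → Fin 4) i) * X (1, (![2, 1, 1, 0, 0, 0] : Fin 6 → Fin 4) i)) *
        (X (2, (![0, 0, 0, 1, 1, 2] : Fin 6 → Fin 4) i) * X (3, (![1, 2, 3, 2, 3, 3] : Fin 6 → Fin 4) i) +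
          X (2, (![1, 2, 3, 2, 3, 3] : Fin 6 → Fin 4) i) * X (3, (![0, 0, 0, 1, 1, 2] : Fin 6 → Fin 4) i)) :
        MvPolynomial (Fin 4 × Fin 4) R) = perPoly (Fin 4) R := by
  rw [perPoly, Matrix.permanent_fin_four_row]
  simp only [Fin.sum_univ_succ, Fin.sum_univ_zero, Matrix.mvPolynomialX_apply, Fin.isValue,
    Matrix.cons_val_zero, Matrix.cons_val_succ, add_zero]
  ring

/-! ### The `29 × 29` pencil -/

/-- `|(Unit ⊕ (β ⊕ β)) ⊕ (Fin 6 ⊕ Fin 6)| = 29` for `β = Fin 2 × Fin 4`. [folklore] -/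
theorem card_index_twentyNine :
    Fintype.card ((Unit ⊕ ((Fin 2 × Fin 4) ⊕ (Fin 2 × Fin 4))) ⊕ (Fin 6 ⊕ Fin 6)) = 29 := by
  simp [Fintype.card_sum, Fintype.card_prod]

/-- **`per₄` has a symmetric affine determinantal representation of size `29`** over every
commutative ring in which `2` is invertible (the two-level bordered Schur design on the Laplace
expansion along the row pairs `{0,1} | {2,3}`, see the module docstring). [folklore] -/
theorem hasSymmDetRepr_perPoly_four_twentyNine (R : Type*) [CommRing R] [Invertible (2 : R)] :
    HasSymmDetRepr (perPoly (Fin 4) R) 29 := by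
  -- column-pair bookkeeping: pair `i = {pc i, pd i}`, complement `{qj i, qk i}`
  obtain ⟨pc, hpc⟩ : ∃ f : Fin 6 → Fin 4, f = ![0, 0, 0, 1, 1, 2] := ⟨_, rfl⟩
  obtain ⟨pd, hpd⟩ : ∃ f : Fin 6 → Fin 4, f = ![1, 2, 3, 2, 3, 3] := ⟨_, rfl⟩
  obtain ⟨qj, hqj⟩ : ∃ f : Fin 6 → Fin 4, f = ![2, 1, 1, 0, 0, 0] := ⟨_, rfl⟩
  obtain ⟨qk, hqk⟩ : ∃ f : Fin 6 → Fin 4, f = ![3, 3, 2, 3, 2, 1] := ⟨_, rfl⟩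
  -- the border: slot `(0, c) ↦ x_{1c}`, slot `(1, c) ↦ x_{3c}`
  obtain ⟨v, hv⟩ : ∃ v : Fin 2 × Fin 4 → MvPolynomial (Fin 4 × Fin 4) R,
      v = fun p => X (if p.1 = 0 then 1 else 3, p.2) := ⟨_, rfl⟩
  -- `Y₁(x₀)` on the row-1 slots, `Y₂(x₂)` on the row-3 slots
  obtain ⟨Y₁, hY₁⟩ : ∃ Y : Matrix (Fin 2 × Fin 4) (Fin 6) (MvPolynomial (Fin 4 × Fin 4) R),
      Y = Matrix.of fun p i => if p.1 = 0 then
        C (-⅟2 : R) * ((if p.2 = qk i then X (0, qj i) else 0) + (if p.2 = qj i then X (0, qk i) else 0))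
        else 0 := ⟨_, rfl⟩
  obtain ⟨Y₂, hY₂⟩ : ∃ Y : Matrix (Fin 2 × Fin 4) (Fin 6) (MvPolynomial (Fin 4 × Fin 4) R),
      Y = Matrix.of fun p i => if p.1 = 1 then
        ((if p.2 = pd i then X (2, pc i) else 0) + (if p.2 = pc i then X (2, pd i) else 0))
        else 0 := ⟨_, rfl⟩
  obtain ⟨Y, hY⟩ : ∃ Y : Matrix (Fin 2 × Fin 4) (Fin 6 ⊕ Fin 6) (MvPolynomial (Fin 4 × Fin 4) R),
      Y = Matrix.of fun p k => Sum.elim (Y₁ p) (Y₂ p) k := ⟨_, rfl⟩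
  -- the blocks
  obtain ⟨T, hT⟩ : ∃ T : Matrix (Fin 6 ⊕ Fin 6) (Fin 6 ⊕ Fin 6) (MvPolynomial (Fin 4 × Fin 4) R),
      T = Matrix.fromBlocks 0 1 1 0 := ⟨_, rfl⟩
  obtain ⟨A₁₁, hA₁₁⟩ : ∃ M : Matrix (Unit ⊕ ((Fin 2 × Fin 4) ⊕ (Fin 2 × Fin 4)))
      (Unit ⊕ ((Fin 2 × Fin 4) ⊕ (Fin 2 × Fin 4))) (MvPolynomial (Fin 4 × Fin 4) R),
      M = Matrix.fromBlocks 0 (replicateRow Unit (Sum.elim v 0)) (replicateCol Unit (Sum.elim v 0))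
        (Matrix.fromBlocks 0 1 1 0) := ⟨_, rfl⟩
  obtain ⟨A₁₂, hA₁₂⟩ : ∃ M : Matrix (Unit ⊕ ((Fin 2 × Fin 4) ⊕ (Fin 2 × Fin 4))) (Fin 6 ⊕ Fin 6)
      (MvPolynomial (Fin 4 × Fin 4) R),
      M = Matrix.of fun i k => Sum.elim (fun _ => 0) (Sum.elim (fun _ => 0) fun p => Y p k) i :=
    ⟨_, rfl⟩
  obtain ⟨A, hA⟩ : ∃ M : Matrix ((Unit ⊕ ((Fin 2 × Fin 4) ⊕ (Fin 2 × Fin 4))) ⊕ (Fin 6 ⊕ Fin 6))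
      ((Unit ⊕ ((Fin 2 × Fin 4) ⊕ (Fin 2 × Fin 4))) ⊕ (Fin 6 ⊕ Fin 6)) (MvPolynomial (Fin 4 × Fin 4) R),
      M = Matrix.fromBlocks A₁₁ A₁₂ A₁₂ᵀ T := ⟨_, rfl⟩
  let e : (Unit ⊕ ((Fin 2 × Fin 4) ⊕ (Fin 2 × Fin 4))) ⊕ (Fin 6 ⊕ Fin 6) ≃ Fin 29 :=
    Fintype.equivFinOfCardEq card_index_twentyNine
  -- (1) symmetry
  have hTsymm : T.IsSymm := by
    rw [hT]
    exact Matrix.IsSymm.fromBlocks (by simp [Matrix.IsSymm]) transpose_one (by simp [Matrix.IsSymm])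
  have hA₁₁symm : A₁₁.IsSymm := by
    rw [hA₁₁]
    exact isSymm_bordered_fromBlocks v (by simp [Matrix.IsSymm])
  have hAsymm : A.IsSymm := by
    rw [hA]
    exact Matrix.IsSymm.fromBlocks hA₁₁symm rfl hTsymm
  -- (2) degrees
  have hX : ∀ s : Fin 4 × Fin 4, (X s : MvPolynomial (Fin 4 × Fin 4) R).totalDegree ≤ 1 :=
    fun s => (isHomogeneous_X R s).totalDegree_le
  have hite : ∀ (c : Prop) [Decidable c] (s : Fin 4 × Fin 4),
      ((if c then X s else 0 : MvPolynomial (Fin 4 × Fin 4) R)).totalDegree ≤ 1 := by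
    intro c _ s
    split_ifs
    · exact hX s
    · simp
  have hY₁deg : ∀ p i, (Y₁ p i).totalDegree ≤ 1 := fun p i => by
    rw [hY₁, Matrix.of_apply]
    by_cases hp : p.1 = 0
    · rw [if_pos hp]
      refine (totalDegree_mul _ _).trans ?_
      rw [totalDegree_C, zero_add]
      exact (totalDegree_add _ _).trans (max_le (hite _ _) (hite _ _))
    · rw [if_neg hp, totalDegree_zero]; exact zero_le_one
  have hY₂deg : ∀ p i, (Y₂ p i).totalDegree ≤ 1 := fun p i => by
    rw [hY₂, Matrix.of_apply]
    by_cases hp : p.1 = 1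
    · rw [if_pos hp]
      exact (totalDegree_add _ _).trans (max_le (hite _ _) (hite _ _))
    · rw [if_neg hp, totalDegree_zero]; exact zero_le_one
  have hYdeg : ∀ p k, (Y p k).totalDegree ≤ 1 := fun p k => by
    rw [hY, Matrix.of_apply]
    rcases k with i | i
    · exact hY₁deg p i
    · exact hY₂deg p i
  have hA₁₂deg : ∀ i k, (A₁₂ i k).totalDegree ≤ 1 := fun i k => by
    rw [hA₁₂, Matrix.of_apply]
    rcases i with ⟨⟩ | (p | p)
    · simp
    · simp
    · exact hYdeg p k
  have hvdeg : ∀ p, (v p).totalDegree ≤ 1 := fun p => by rw [hv]; exact hX _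
  have hTdeg : ∀ k l, (T k l).totalDegree ≤ 1 := fun k l => by
    rcases k with i | i <;> rcases l with j | j
    · simp [hT]
    · simp only [hT, Matrix.fromBlocks_apply₁₂, Matrix.one_apply]
      split_ifs <;> simp
    · simp only [hT, Matrix.fromBlocks_apply₂₁, Matrix.one_apply]
      split_ifs <;> simp
    · simp [hT]
  have hAdeg : ∀ a b, (A a b).totalDegree ≤ 1 := fun a b => by
    rcases a with a | a <;> rcases b with b | b
    · rw [hA, Matrix.fromBlocks_apply₁₁, hA₁₁]
      exact totalDegree_bordered_fromBlocks_le v 0 hvdeg (fun _ _ => by simp) a b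
    · rw [hA, Matrix.fromBlocks_apply₁₂]; exact hA₁₂deg a b
    · rw [hA, Matrix.fromBlocks_apply₂₁, Matrix.transpose_apply]; exact hA₁₂deg b a
    · rw [hA, Matrix.fromBlocks_apply₂₂]; exact hTdeg a b
  -- (3) determinant: eliminate the constant invertible block `T`
  have hTT : T * T = 1 := by
    rw [hT]
    simpa using fromBlocks_zero_one_one_mul (0 : Matrix (Fin 6) (Fin 6) (MvPolynomial (Fin 4 × Fin 4) R))
  have hTdet : T.det = 1 := by
    rw [hT, det_fromBlocks_zero_one_one]; norm_num
  letI : Invertible T := invertibleOfRightInverse _ _ hTT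
  have hTinv : ⅟T = T := invOf_eq_right_inv hTT
  -- the Schur complement `S' = −(Y₁ Y₂ᵀ + Y₂ Y₁ᵀ)` appears as the new pairing block
  obtain ⟨S', hS'⟩ : ∃ S : Matrix (Fin 2 × Fin 4) (Fin 2 × Fin 4) (MvPolynomial (Fin 4 × Fin 4) R),
      S = Matrix.of fun p q => -∑ i : Fin 6, (Y₁ p i * Y₂ q i + Y₂ p i * Y₁ q i) := ⟨_, rfl⟩
  have hprod : ∀ a b, (A₁₂ * T * A₁₂ᵀ) a b =
      Sum.elim (fun _ => 0) (Sum.elim (fun _ => 0) fun p =>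
        Sum.elim (fun _ => 0) (Sum.elim (fun _ => 0) fun q => -S' p q) b) a := by
    intro a b
    have hab : (A₁₂ * T * A₁₂ᵀ) a b = ∑ k, ∑ l, A₁₂ a k * T k l * A₁₂ b l := by
      simp only [Matrix.mul_apply, Matrix.transpose_apply, Finset.sum_mul]
      rw [Finset.sum_comm]
    rw [hab, hT, sum_sum_fromBlocks_swap]
    rcases a with ⟨⟩ | (p | p)
    · simp only [hA₁₂, Matrix.of_apply, Sum.elim_inl, zero_mul, add_zero, Finset.sum_const_zero]
    · simp only [hA₁₂, Matrix.of_apply, Sum.elim_inl, Sum.elim_inr, zero_mul, add_zero,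
        Finset.sum_const_zero]
    · rcases b with ⟨⟩ | (q | q)
      · simp only [hA₁₂, Matrix.of_apply, Sum.elim_inl, Sum.elim_inr, mul_zero, add_zero,
          Finset.sum_const_zero]
      · simp only [hA₁₂, Matrix.of_apply, Sum.elim_inl, Sum.elim_inr, mul_zero, add_zero,
          Finset.sum_const_zero]
      · simp only [hA₁₂, hY, hS', Matrix.of_apply, Sum.elim_inl, Sum.elim_inr, neg_neg]
  have hschur : A₁₁ - A₁₂ * ⅟T * A₁₂ᵀ =
      Matrix.fromBlocks 0 (replicateRow Unit (Sum.elim v 0)) (replicateCol Unit (Sum.elim v 0))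
        (Matrix.fromBlocks 0 1 1 S') := by
    rw [hTinv]
    ext a b
    rw [Matrix.sub_apply, hprod, hA₁₁]
    rcases a with ⟨⟩ | (p | p) <;> rcases b with ⟨⟩ | (q | q) <;> simp
  -- the border sums `Y₁ᵀ r = −⅟2 · h`, `Y₂ᵀ r = g`
  have hsum₁ : ∀ i, ∑ p, v p * Y₁ p i =
      C (-⅟2 : R) * (X (0, qj i) * X (1, qk i) + X (0, qk i) * X (1, qj i)) := by
    intro i
    rw [hv, hY₁]
    simp only [Matrix.of_apply, Fintype.sum_prod_type, Fin.sum_univ_two, Fin.sum_univ_four,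
      Fin.isValue, if_true, one_ne_zero, if_false, mul_zero, add_zero]
    rw [hqj, hqk]
    fin_cases i <;> simp <;> ring
  have hsum₂ : ∀ i, ∑ q, v q * Y₂ q i =
      X (2, pc i) * X (3, pd i) + X (2, pd i) * X (3, pc i) := by
    intro i
    rw [hv, hY₂]
    simp only [Matrix.of_apply, Fintype.sum_prod_type, Fin.sum_univ_two, Fin.sum_univ_four,
      Fin.isValue, if_true, zero_ne_one, if_false, mul_zero, zero_add]
    rw [hpc, hpd]
    fin_cases i <;> simp <;> ring
  have h2 : (2 : MvPolynomial (Fin 4 × Fin 4) R) * C (-⅟2 : R) = -1 := by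
    rw [← map_ofNat C 2, ← map_mul, mul_neg, mul_invOf_self, map_neg, map_one]
  have hform : ∑ p, ∑ q, v p * S' p q * v q = perPoly (Fin 4) R := by
    -- unfold the Schur complement entrywise
    have hpq : ∀ p q, v p * S' p q * v q =
        ∑ i, (-(v p * Y₁ p i * (v q * Y₂ q i)) + -(v p * Y₂ p i * (v q * Y₁ q i))) := by
      intro p q
      rw [hS', Matrix.of_apply, mul_neg, neg_mul, Finset.mul_sum, Finset.sum_mul,
        ← Finset.sum_neg_distrib]
      exact Finset.sum_congr rfl fun i _ => by ring
    -- reorder the sums and factor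
    have e0 : ∑ p, ∑ q, v p * S' p q * v q =
        ∑ p, ∑ q, ∑ i, (-(v p * Y₁ p i * (v q * Y₂ q i)) + -(v p * Y₂ p i * (v q * Y₁ q i))) :=
      Finset.sum_congr rfl fun p _ => Finset.sum_congr rfl fun q _ => hpq p q
    have e1 : ∑ p, ∑ q, ∑ i, (-(v p * Y₁ p i * (v q * Y₂ q i)) + -(v p * Y₂ p i * (v q * Y₁ q i))) =
        ∑ p, ∑ i, ∑ q, (-(v p * Y₁ p i * (v q * Y₂ q i)) + -(v p * Y₂ p i * (v q * Y₁ q i))) :=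
      Finset.sum_congr rfl fun p _ => Finset.sum_comm
    have e2 : ∑ p, ∑ i, ∑ q, (-(v p * Y₁ p i * (v q * Y₂ q i)) + -(v p * Y₂ p i * (v q * Y₁ q i))) =
        ∑ i, ∑ p, ∑ q, (-(v p * Y₁ p i * (v q * Y₂ q i)) + -(v p * Y₂ p i * (v q * Y₁ q i))) :=
      Finset.sum_comm
    have e3 : ∀ i, ∑ p, ∑ q, (-(v p * Y₁ p i * (v q * Y₂ q i)) + -(v p * Y₂ p i * (v q * Y₁ q i))) =
        -((∑ p, v p * Y₁ p i) * (∑ q, v q * Y₂ q i)) + -((∑ p, v p * Y₂ p i) * (∑ q, v q * Y₁ q i)) := by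
      intro i
      simp only [Finset.sum_add_distrib, Finset.sum_neg_distrib, Finset.sum_mul_sum]
    rw [e0, e1, e2, Finset.sum_congr rfl fun i _ => e3 i]
    simp only [hsum₁, hsum₂]
    rw [← laplace_perPoly_four_rows R, ← hpc, ← hpd, ← hqj, ← hqk]
    refine Finset.sum_congr rfl fun i _ => ?_
    linear_combination (-((X (0, qj i) * X (1, qk i) + X (0, qk i) * X (1, qj i)) *
      (X (2, pc i) * X (3, pd i) + X (2, pd i) * X (3, pc i))) : MvPolynomial (Fin 4 × Fin 4) R) * h2
  have hdet : A.det = perPoly (Fin 4) R := by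
    rw [hA, Matrix.det_fromBlocks₂₂, hTdet, one_mul, hschur, det_bordered_fromBlocks, hform]
    norm_num [Fintype.card_prod]
  -- assemble
  refine ⟨Matrix.reindex e e A, hAsymm.submatrix _, ?_, ?_⟩
  · intro i j
    simpa only [Matrix.reindex_apply, Matrix.submatrix_apply] using hAdeg (e.symm i) (e.symm j)
  · rw [Matrix.det_reindex_self, hdet]

/-- **`sdc(per₄) ≤ 29`** over any field with `2 ≠ 0`. [folklore] -/
theorem sdc_perPoly_four_le_twentyNine (K : Type*) [Field K] (h2 : (2 : K) ≠ 0) :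
    symmDeterminantalComplexity (perPoly (Fin 4) K) ≤ 29 := by
  letI : Invertible (2 : K) := invertibleOfNonzero h2
  exact symmDeterminantalComplexity_le (hasSymmDetRepr_perPoly_four_twentyNine K)

/-- **The window `25 ≤ sdc(per₄) ≤ 29`** over any field of characteristic `0`: the lower bound is
the cell's kernel-package rung (`SymPencilSdcPerFourTwentyFive`), the upper bound the explicit
pencil of this file. [folklore] -/
theorem sdc_perPoly_four_window_twentyNine (K : Type*) [Field K] [CharZero K] :
    25 ≤ symmDeterminantalComplexity (perPoly (Fin 4) K) ∧
      symmDeterminantalComplexity (perPoly (Fin 4) K) ≤ 29 :=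
  ⟨(sdc_perPoly_four_window_twentyFive K).1, sdc_perPoly_four_le_twentyNine K two_ne_zero⟩

/-- The complex instance: `25 ≤ sdc(per₄) ≤ 29` over `ℂ`. [folklore] -/
theorem sdc_perPoly_four_window_twentyNine_complex :
    25 ≤ symmDeterminantalComplexity (perPoly (Fin 4) ℂ) ∧
      symmDeterminantalComplexity (perPoly (Fin 4) ℂ) ≤ 29 :=
  sdc_perPoly_four_window_twentyNine ℂ

end Summit.ValiantsHypothesis.ValiantsHypothesis.Theorems.SymPencilSdcPerFourTwentyNine

end
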